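import Mathlib.Analysis.SpecificLimits.Normed
import Mathlib.Analysis.SpecialFunctions.Pow.NNReal
import Literature.Computability.AlgebraicComplexity.TensorMultiples
import Literature.Computability.AlgebraicComplexity.SchoenhageTau
import HarnessLib

/-!
# Schönhage's asymptotic sum inequality for the rank (Bläser 2013, Thm. 7.5) — proved

Topic `Literature/Computability/AlgebraicComplexity`. The tree vendors Schönhage's `τ`-theorem in
its border-rank form as the named fact `Blaser2013_thm75` (`SchoenhageTau.lean`, not proved). This
file PROVES the rank version, which is what the group-theoretic approach uses
(`GroupTheoreticMatMulProofs.lean`, CKSU 2005 Thm. 5.5):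

* `asymptoticSumInequality_rank`: over any field `K`, if `R(⊕_{i<p} ⟨kᵢ, mᵢ, nᵢ⟩) ≤ r`
  (`matMulDirectSum K k m n` of `SchoenhageTau.lean`) then `∑ᵢ (kᵢ mᵢ nᵢ)^{ω(K)/3} ≤ r`;
* `asymptoticSumInequality_rank_tau`: the printed form — `r > p` and `∑ᵢ (kᵢmᵢnᵢ)^τ = r` give
  `ω ≤ 3τ` (via `omega_le_three_mul_of_sum_rpow_omega_le`, the passage from the sum inequality to
  the `τ`-form, shared with the border rank version `Blaser2013_thm75_holds`).

Everything is over a field `K : Type u` in any universe.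

This is Bläser 2013, Thm. 7.5 ("If `R̲(⊕ ⟨kᵢ,mᵢ,nᵢ⟩) ≤ r` with `r > p` then `ω ≤ 3τ` where
`∑ (kᵢmᵢnᵢ)^τ = r`") with rank `R ≥ R̲` in the hypothesis — weaker than print in the hypothesis,
identical conclusion (`∑ (kᵢmᵢnᵢ)^{ω/3} ≤ r ⇔ ω ≤ 3τ` by monotonicity), and without the side
condition `r > p` (not needed for the rank: blocks `⟨1,1,1⟩` are handled by the flattening bound);
Bürgisser–Clausen–Shokrollahi 1997, (15.11); Schönhage 1981.

## Proof (Bläser 2013, pp. 32–34, adapted to exact rank, so no `ε`-bookkeeping `c_h`)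

Let `D = ⊕ᵢ ⟨kᵢ,mᵢ,nᵢ⟩`, `xᵢ = (kᵢmᵢnᵢ)^{ω/3}`, `S = ∑ xᵢ`. Then `R(D^{⊗N}) ≤ rᴺ`
(`tensorRank_kroneckerPow_le`) and `Sᴺ = ∑_{τ : Fin N → Fin p} ∏ⱼ x_{τ j}` (`Fintype.sum_pow`).
Group the words `τ` by their type `σ` (`σᵢ = #{j | τ j = i}`; at most `(N+1)ᵖ` types).
All `F` words of one type have blocks of the same format `⟨K',M',N'⟩ = ⟨∏ kᵢ^{σᵢ}, …⟩`, and
`F ⊙ ⟨K',M',N'⟩` is a restriction of `D^{⊗N}` (`tensorRank_multiple_le_kroneckerPow_matMulDirectSum`),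
so `R(F ⊙ ⟨K',M',N'⟩) ≤ rᴺ`. By the flattening bound `F ≤ rᴺ`, and by Lemma 7.7
(`Blaser2013_lemma77_rpow`, with `q = ⌊rᴺ/F⌋ + 1`) `F (K'M'N')^{ω/3} ≤ 2rᴺ`
(`card_mul_rpow_le_of_class`). Summing over types, `Sᴺ ≤ 2 (N+1)ᵖ rᴺ` for all `N`
(`sum_rpow_pow_le`), whence `S ≤ r` (`Nᵖ/aᴺ → 0` for `a > 1`).

## References

* M. Bläser, *Fast Matrix Multiplication*, Theory of Computing Library, Graduate Surveys 5 (2013),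
  doi:10.4086/toc.gs.2013.005 (held: `paper:doi-10-4086-toc-gs-2013-005`, read pp. 30–34): Thm. 7.5,
  Notation 7.6, Lemma 7.7, proof of Thm. 7.5 (pp. 32–34, eq. (7.1)). [Blaser2013]
* P. Bürgisser, M. Clausen, M. A. Shokrollahi, *Algebraic Complexity Theory*, Springer 1997,
  (15.11) (the asymptotic sum inequality, cited as such by CKSU 2005). [BurgisserClausenShokrollahi1997]
* A. Schönhage, *Partial and total matrix multiplication*, SIAM J. Comput. 10 (1981) 434–455
  (original; cited through Bläser 2013, [28]).
-/

noncomputable section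

open scoped BigOperators
open Filter Topology

namespace Literature.Computability.AlgebraicComplexity

universe u

/-! ## Types of words -/

section WordType

variable {N p : ℕ}

/-- `∏ⱼ k_{τ j} = ∏ᵢ kᵢ^{σᵢ}` where `σᵢ = #{j | τ j = i}` is the *type* of the word `τ : Fin N → Fin p`
(Bläser 2013, proof of Thm. 7.5: `k' = ∏ kᵢ^{σᵢ}`). [cite: Blaser2013, Thm. 7.5 (proof)] -/
theorem prod_eq_prod_pow_card_filter (τ : Fin N → Fin p) (k : Fin p → ℕ) :
    ∏ j, k (τ j) = ∏ i, k i ^ (Finset.univ.filter fun j => τ j = i).card := by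
  rw [← Finset.prod_fiberwise Finset.univ τ (fun j => k (τ j))]
  refine Finset.prod_congr rfl fun i _ => ?_
  rw [Finset.prod_congr rfl (fun j hj => by rw [(Finset.mem_filter.1 hj).2] :
    ∀ j ∈ Finset.univ.filter (fun j => τ j = i), k (τ j) = k i), Finset.prod_const]

/-- Words of the same type have the same `∏ⱼ k_{τ j}`. [cite: Blaser2013, Thm. 7.5 (proof)] -/
theorem prod_eq_of_card_filter_eq {τ τ' : Fin N → Fin p}
    (h : ∀ i, (Finset.univ.filter fun j => τ j = i).card = (Finset.univ.filter fun j => τ' j = i).card)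
    (k : Fin p → ℕ) : ∏ j, k (τ j) = ∏ j, k (τ' j) := by
  rw [prod_eq_prod_pow_card_filter, prod_eq_prod_pow_card_filter]
  exact Finset.prod_congr rfl fun i _ => by rw [h i]

end WordType

/-! ## Extracting the blocks of one type from `(⊕ᵢ ⟨kᵢ,mᵢ,nᵢ⟩)^{⊗N}` -/

section Blocks

variable (K : Type u) [CommSemiring K] {p : ℕ} (k m n : Fin p → ℕ)

/-- `if`-congruence along `P ↔ Q` with the `Decidable` instances taken from the goal (unification,
not synthesis). [folklore] -/
theorem ite_congr_prop {M : Type*} {P Q : Prop} {_ : Decidable P} {_ : Decidable Q} {a b : M}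
    (h : P ↔ Q) : (if P then a else b) = if Q then a else b := by
  by_cases hP : P
  · rw [if_pos hP, if_pos (h.1 hP)]
  · rw [if_neg hP, if_neg (fun hQ => hP (h.2 hQ))]

/-- **Block extraction.** Let `D = ⊕ᵢ ⟨kᵢ, mᵢ, nᵢ⟩` and let `rep : Fin F → (Fin N → Fin p)` be an
injective family of words all of whose blocks have the same format `⟨K', M', N'⟩`
(`∏ⱼ k_{rep β j} = K'` etc., e.g. all words of one type). Then `F ⊙ ⟨K', M', N'⟩ = ⟨F⟩ ⊗ ⟨K',M',N'⟩`
is a restriction of `D^{⊗N}` along index maps (block `β`, matrix index `κ < K'` ↦ the word of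
`Σ`-indices `j ↦ ⟨rep β j, digit j of κ⟩` for any bijections `Fin K' ≃ ∏ⱼ Fin k_{rep β j}`), so
`R(F ⊙ ⟨K', M', N'⟩) ≤ R(D^{⊗N})` (Bläser 2013, proof of Thm. 7.5:
`D^{⊗s} = ⊕_σ (s!/σ₁!⋯σ_p!) ⊙ ⟨∏ kᵢ^{σᵢ}, ∏ mᵢ^{σᵢ}, ∏ nᵢ^{σᵢ}⟩`, the part of it that is used).
[cite: Blaser2013, Thm. 7.5 (proof)] -/
theorem tensorRank_multiple_le_kroneckerPow_matMulDirectSum {N F K' M' N' : ℕ}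
    (rep : Fin F → (Fin N → Fin p)) (hrep : Function.Injective rep)
    (hK : ∀ β, ∏ j, k (rep β j) = K') (hM : ∀ β, ∏ j, m (rep β j) = M')
    (hN : ∀ β, ∏ j, n (rep β j) = N') :
    tensorRank (kroneckerTensor (unitTensor K F) (matMulTensor K K' M' N')) ≤
      tensorRank (kroneckerPow (matMulDirectSum K k m n) N) := by
  classical
  -- bijections `Fin K' ≃ ∏ⱼ Fin (k (rep β j))` etc. from the cardinalities
  obtain ⟨eK, -⟩ : ∃ _e : ∀ β, Fin K' ≃ (∀ j : Fin N, Fin (k (rep β j))), True :=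
    ⟨fun β => (Fintype.equivFinOfCardEq ((Fintype.card_pi (α := fun j => Fin (k (rep β j)))).trans
      (by simp only [Fintype.card_fin]; exact hK β))).symm, trivial⟩
  obtain ⟨eM, -⟩ : ∃ _e : ∀ β, Fin M' ≃ (∀ j : Fin N, Fin (m (rep β j))), True :=
    ⟨fun β => (Fintype.equivFinOfCardEq ((Fintype.card_pi (α := fun j => Fin (m (rep β j)))).trans
      (by simp only [Fintype.card_fin]; exact hM β))).symm, trivial⟩
  obtain ⟨eN, -⟩ : ∃ _e : ∀ β, Fin N' ≃ (∀ j : Fin N, Fin (n (rep β j))), True :=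
    ⟨fun β => (Fintype.equivFinOfCardEq ((Fintype.card_pi (α := fun j => Fin (n (rep β j)))).trans
      (by simp only [Fintype.card_fin]; exact hN β))).symm, trivial⟩
  have key : kroneckerTensor (unitTensor K F) (matMulTensor K K' M' N') = fun a b c =>
      kroneckerPow (matMulDirectSum K k m n) N
        (fun j => ⟨rep a.1 j, (eK a.1 a.2.1 j, eN a.1 a.2.2 j)⟩)
        (fun j => ⟨rep b.1 j, (eK b.1 b.2.1 j, eM b.1 b.2.2 j)⟩)
        (fun j => ⟨rep c.1 j, (eM c.1 c.2.1 j, eN c.1 c.2.2 j)⟩) := by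
    funext a b c
    obtain ⟨β₁, κ, ν⟩ := a
    obtain ⟨β₂, κ', μ'⟩ := b
    obtain ⟨β₃, μ'', ν''⟩ := c
    simp only [kroneckerTensor_unitTensor_apply, matMulTensor, kroneckerPow_apply, matMulDirectSum]
    rw [Fintype.prod_boole, ← ite_and]
    refine ite_congr_prop ?_
    constructor
    · rintro ⟨⟨rfl, rfl⟩, rfl, rfl, rfl⟩ j
      simp
    · intro H
      have h12 : β₁ = β₂ := by
        by_contra hne
        obtain ⟨j, hj⟩ := Function.ne_iff.1 (fun h => hne (hrep h) : rep β₁ ≠ rep β₂)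
        exact hj (H j).1
      subst h12
      have h13 : β₁ = β₃ := by
        by_contra hne
        obtain ⟨j, hj⟩ := Function.ne_iff.1 (fun h => hne (hrep h) : rep β₁ ≠ rep β₃)
        exact hj (H j).2.1
      subst h13
      refine ⟨⟨rfl, rfl⟩, ?_, ?_, ?_⟩
      · exact (eK β₁).injective (funext fun j => Fin.ext (H j).2.2.1)
      · exact (eM β₁).injective (funext fun j => Fin.ext (H j).2.2.2.1)
      · exact (eN β₁).injective (funext fun j => Fin.ext (H j).2.2.2.2)
  rw [key]
  exact tensorRank_precomp_le _ _ _ _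

end Blocks

/-! ## The bound for one type class -/

section ClassBound

variable (K : Type u) [Field K] {p : ℕ} (k m n : Fin p → ℕ)

/-- **One type class contributes at most `2 rᴺ`.** With `D`, `rep` as in
`tensorRank_multiple_le_kroneckerPow_matMulDirectSum` and `R(D^{⊗N}) ≤ rᴺ`:
`F · (K'M'N')^{ω/3} ≤ 2 rᴺ`.  Cases: `K'M'N' = 0` (trivial); otherwise `F ≤ R(F ⊙ ⟨K',M',N'⟩) ≤ rᴺ`
by the flattening bound, which settles `K'M'N' = 1`; for `K'M'N' ≥ 2` Lemma 7.7 with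
`q = ⌊rᴺ/F⌋ + 1` gives `(K'M'N')^{ω/3} ≤ q` and `F q ≤ rᴺ + F ≤ 2rᴺ` (Bläser 2013, proof of Thm. 7.5,
eq. (7.1) and the application of Lemma 7.7). [cite: Blaser2013, Thm. 7.5 (proof)] -/
theorem card_mul_rpow_le_of_class {N F K' M' N' r : ℕ}
    (hD : tensorRank (kroneckerPow (matMulDirectSum K k m n) N) ≤ r ^ N)
    (rep : Fin F → (Fin N → Fin p)) (hrep : Function.Injective rep)
    (hK : ∀ β, ∏ j, k (rep β j) = K') (hM : ∀ β, ∏ j, m (rep β j) = M')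
    (hN : ∀ β, ∏ j, n (rep β j) = N') :
    (F : ℝ) * ((K' * M' * N' : ℕ) : ℝ) ^ (omega K / 3) ≤ 2 * (r : ℝ) ^ N := by
  have hω : omega K / 3 ≠ 0 := by
    have := omega_two_le (K := K); positivity
  have hle : tensorRank (kroneckerTensor (unitTensor K F) (matMulTensor K K' M' N')) ≤ r ^ N :=
    (tensorRank_multiple_le_kroneckerPow_matMulDirectSum K k m n rep hrep hK hM hN).trans hD
  rcases Nat.eq_zero_or_pos (K' * M' * N') with h0 | hpos
  · rw [h0, Nat.cast_zero, Real.zero_rpow hω, mul_zero]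
    positivity
  -- `K', M', N' ≥ 1`: the flattening bound `F ≤ R(F ⊙ ⟨K',M',N'⟩) ≤ r^N`
  have hK' : 0 < K' := Nat.pos_of_ne_zero fun h => by simp [h] at hpos
  have hM' : 0 < M' := Nat.pos_of_ne_zero fun h => by simp [h] at hpos
  have hN' : 0 < N' := Nat.pos_of_ne_zero fun h => by simp [h] at hpos
  have hF : F ≤ r ^ N := by
    refine le_trans (le_tensorRank_multiple F (matMulTensor K K' M' N')
      (a₀ := (⟨0, hK'⟩, ⟨0, hN'⟩)) (b₀ := (⟨0, hK'⟩, ⟨0, hM'⟩)) (c₀ := (⟨0, hM'⟩, ⟨0, hN'⟩)) ?_) hle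
    simp [matMulTensor]
  have hFr : (F : ℝ) ≤ (r : ℝ) ^ N := by exact_mod_cast hF
  rcases Nat.eq_or_lt_of_le hpos with h1 | h2
  · -- `K'M'N' = 1`
    rw [← h1, Nat.cast_one, Real.one_rpow, mul_one]
    have : (0 : ℝ) ≤ (r : ℝ) ^ N := by positivity
    linarith
  · -- `K'M'N' ≥ 2`: Lemma 7.7 with `q = ⌊r^N / F⌋ + 1`
    rcases Nat.eq_zero_or_pos F with hF0 | hFpos
    · rw [hF0, Nat.cast_zero, zero_mul]
      positivity
    set q : ℕ := r ^ N / F + 1 with hq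
    have hqF : r ^ N ≤ q * F := by
      rw [hq, Nat.add_mul, one_mul, mul_comm]
      have := Nat.div_add_mod (r ^ N) F
      have := Nat.mod_lt (r ^ N) hFpos
      omega
    have h77 := Blaser2013_lemma77_rpow K hFpos h2 (hle.trans hqF)
    have hqF' : (F : ℝ) * q ≤ 2 * (r : ℝ) ^ N := by
      have h3 : F * q ≤ r ^ N + F := by
        rw [hq, Nat.mul_add, mul_one]
        exact Nat.add_le_add_right (Nat.mul_div_le (r ^ N) F) F
      have h4 : ((F * q : ℕ) : ℝ) ≤ ((r ^ N + F : ℕ) : ℝ) := by exact_mod_cast h3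
      push_cast at h4
      linarith
    calc (F : ℝ) * ((K' * M' * N' : ℕ) : ℝ) ^ (omega K / 3) ≤ (F : ℝ) * q :=
        mul_le_mul_of_nonneg_left h77 (Nat.cast_nonneg _)
      _ ≤ 2 * (r : ℝ) ^ N := hqF'

end ClassBound

/-! ## The asymptotic sum inequality for the rank -/

section ASI

variable (K : Type u) [Field K] {p : ℕ} (k m n : Fin p → ℕ)

/-- **`(∑ᵢ (kᵢmᵢnᵢ)^{ω/3})ᴺ ≤ 2 (N+1)ᵖ rᴺ`** whenever `R(⊕ᵢ ⟨kᵢ,mᵢ,nᵢ⟩) ≤ r` (Bläser 2013, proof of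
Thm. 7.5: expand the `N`-th power as a sum over words `τ`, group the words by type — at most
`(N+1)ᵖ` types (Bläser: `≤ (s+1)^{p-1}`) — and bound each type class by `2rᴺ`).
[cite: Blaser2013, Thm. 7.5 (proof)] -/
theorem sum_rpow_pow_le {r : ℕ} (h : tensorRank (matMulDirectSum K k m n) ≤ r) (N : ℕ) :
    (∑ i, ((k i * m i * n i : ℕ) : ℝ) ^ (omega K / 3)) ^ N ≤
      2 * ((N : ℝ) + 1) ^ p * (r : ℝ) ^ N := by
  classical
  have hD : tensorRank (kroneckerPow (matMulDirectSum K k m n) N) ≤ r ^ N :=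
    (tensorRank_kroneckerPow_le _ N).trans (Nat.pow_le_pow_left h N)
  -- the value of a word
  set X : (Fin N → Fin p) → ℝ := fun τ =>
    (((∏ j, k (τ j)) * (∏ j, m (τ j)) * (∏ j, n (τ j)) : ℕ) : ℝ) ^ (omega K / 3) with hX
  have hexpand : (∑ i, ((k i * m i * n i : ℕ) : ℝ) ^ (omega K / 3)) ^ N = ∑ τ : Fin N → Fin p, X τ := by
    rw [Fintype.sum_pow]
    refine Finset.sum_congr rfl fun τ _ => ?_
    rw [hX]
    dsimp only
    rw [Real.finsetProd_rpow _ _ (fun i _ => by positivity)]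
    congr 1
    push_cast
    rw [Finset.prod_mul_distrib, Finset.prod_mul_distrib]
  -- the type of a word, `σᵢ = #{j | τ j = i} ≤ N`
  obtain ⟨wt, hwt⟩ : ∃ wt : (Fin N → Fin p) → (Fin p → Fin (N + 1)),
      ∀ τ i, ((wt τ i : Fin (N + 1)) : ℕ) = (Finset.univ.filter fun j => τ j = i).card :=
    ⟨fun τ i => ⟨(Finset.univ.filter fun j => τ j = i).card,
      Nat.lt_succ_of_le ((Finset.card_filter_le _ _).trans (by simp))⟩, fun τ i => rfl⟩
  rw [hexpand, ← Finset.sum_fiberwise Finset.univ wt X]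
  -- each type class contributes at most `2 r^N`
  have hclass : ∀ c : Fin p → Fin (N + 1),
      ∑ τ ∈ Finset.univ.filter (fun τ => wt τ = c), X τ ≤ 2 * (r : ℝ) ^ N := by
    intro c
    set S := Finset.univ.filter (fun τ : Fin N → Fin p => wt τ = c) with hS
    rcases S.eq_empty_or_nonempty with hemp | ⟨τ₀, hτ₀⟩
    · rw [hemp, Finset.sum_empty]
      positivity
    have hmem : ∀ τ ∈ S, ∀ i, (Finset.univ.filter fun j => τ j = i).card =
        (Finset.univ.filter fun j => τ₀ j = i).card := fun τ hτ i => by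
      rw [← hwt, ← hwt, (Finset.mem_filter.1 hτ).2, (Finset.mem_filter.1 hτ₀).2]
    have hconst : ∀ τ ∈ S, X τ = X τ₀ := fun τ hτ => by
      simp only [hX]
      rw [prod_eq_of_card_filter_eq (hmem τ hτ) k, prod_eq_of_card_filter_eq (hmem τ hτ) m,
        prod_eq_of_card_filter_eq (hmem τ hτ) n]
    rw [Finset.sum_congr rfl hconst, Finset.sum_const, nsmul_eq_mul]
    -- the class as an injective family
    set rep : Fin S.card → (Fin N → Fin p) := fun β => (S.equivFin.symm β).1 with hrep
    have hrep_mem : ∀ β, rep β ∈ S := fun β => (S.equivFin.symm β).2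
    have hinj : Function.Injective rep := fun β β' hβ =>
      S.equivFin.symm.injective (Subtype.ext hβ)
    exact card_mul_rpow_le_of_class K k m n hD rep hinj
      (fun β => prod_eq_of_card_filter_eq (hmem _ (hrep_mem β)) k)
      (fun β => prod_eq_of_card_filter_eq (hmem _ (hrep_mem β)) m)
      (fun β => prod_eq_of_card_filter_eq (hmem _ (hrep_mem β)) n)
  calc ∑ c : Fin p → Fin (N + 1), ∑ τ ∈ Finset.univ.filter (fun τ => wt τ = c), X τ
      ≤ ∑ _c : Fin p → Fin (N + 1), 2 * (r : ℝ) ^ N := Finset.sum_le_sum fun c _ => hclass c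
    _ = 2 * ((N : ℝ) + 1) ^ p * (r : ℝ) ^ N := by
      rw [Finset.sum_const, Finset.card_univ, Fintype.card_fun, Fintype.card_fin, Fintype.card_fin,
        nsmul_eq_mul]
      push_cast
      ring

/-- **Schönhage's asymptotic sum inequality, rank version** (Bläser 2013, Thm. 7.5 = Schönhage's
`τ`-theorem, for the rank `R` in place of the border rank; Bürgisser–Clausen–Shokrollahi 1997,
(15.11); Schönhage 1981): if `R(⊕_{i=1}^p ⟨kᵢ, mᵢ, nᵢ⟩) ≤ r` then `∑ᵢ (kᵢ mᵢ nᵢ)^{ω/3} ≤ r`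
(equivalently `ω ≤ 3τ` for the `τ` with `∑ (kᵢmᵢnᵢ)^τ = r`).  From `sum_rpow_pow_le`:
`Sᴺ ≤ 2(N+1)ᵖ rᴺ` for all `N` forces `S ≤ r` since `Nᵖ = o(aᴺ)` for `a > 1`.
[cite: Blaser2013, Thm. 7.5] [cite: BurgisserClausenShokrollahi1997, (15.11)] -/
theorem asymptoticSumInequality_rank {r : ℕ} (h : tensorRank (matMulDirectSum K k m n) ≤ r) :
    ∑ i, ((k i * m i * n i : ℕ) : ℝ) ^ (omega K / 3) ≤ r := by
  set S : ℝ := ∑ i, ((k i * m i * n i : ℕ) : ℝ) ^ (omega K / 3) with hS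
  have hS0 : 0 ≤ S := Finset.sum_nonneg fun i _ => by positivity
  have hpow := sum_rpow_pow_le K k m n h
  by_contra hlt
  rw [not_le] at hlt
  rcases Nat.eq_zero_or_pos r with hr | hr
  · -- `r = 0`: `S^1 ≤ 0`
    have h1 : S ^ 1 ≤ 2 * (((1 : ℕ) : ℝ) + 1) ^ p * (r : ℝ) ^ 1 := hpow 1
    rw [hr] at h1 hlt
    simp only [pow_one, Nat.cast_zero, mul_zero] at h1 hlt
    exact absurd h1 (not_le.2 hlt)
  · have hr0 : (0 : ℝ) < r := by exact_mod_cast hr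
    set a : ℝ := S / r with ha
    have ha1 : 1 < a := (one_lt_div hr0).2 hlt
    have ha0 : 0 < a := zero_lt_one.trans ha1
    have hSa : S = a * r := by rw [ha, div_mul_cancel₀ _ hr0.ne']
    -- `a^N ≤ 2 (N+1)^p`
    have hpow' : ∀ N : ℕ, a ^ N ≤ 2 * ((N : ℝ) + 1) ^ p := by
      intro N
      have h1 : S ^ N ≤ 2 * ((N : ℝ) + 1) ^ p * (r : ℝ) ^ N := hpow N
      rw [hSa, mul_pow] at h1
      exact le_of_mul_le_mul_right (by linarith) (pow_pos hr0 N)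
    -- but `(N+1)^p / a^(N+1) → 0`
    have hlim : Tendsto (fun N : ℕ => (((N + 1 : ℕ) : ℝ)) ^ p / a ^ (N + 1)) atTop (𝓝 0) :=
      (tendsto_pow_const_div_const_pow_of_one_lt p ha1).comp (tendsto_add_atTop_nat 1)
    have hsmall : (0 : ℝ) < 1 / (2 * a) := by positivity
    obtain ⟨N, hN⟩ := (hlim.eventually (gt_mem_nhds hsmall)).exists
    rw [div_lt_div_iff₀ (by positivity) (by positivity), one_mul, pow_succ] at hN
    have h2 := mul_le_mul_of_nonneg_right (hpow' N) ha0.le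
    push_cast at hN
    linarith

/-- **From the sum inequality to Bläser's printed `τ`-form**: if `∑ᵢ (kᵢ mᵢ nᵢ)^{ω/3} ≤ r` with
`r > p`, then `ω ≤ 3τ` for the (unique) `τ` with `∑ᵢ (kᵢ mᵢ nᵢ)^τ = r` — `r > p` forces some
`kᵢmᵢnᵢ ≥ 2`, where `x ↦ (kᵢmᵢnᵢ)^x` is strictly increasing, so `∑ (kᵢmᵢnᵢ)^{ω/3} ≤ ∑ (kᵢmᵢnᵢ)^τ`
is impossible for `τ < ω/3` (the step "`ω ≤ 3τ` where `τ` is defined by `∑ (kᵢmᵢnᵢ)^τ = r`" of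
Bläser 2013, Thm. 7.5, shared by the rank and the border rank versions).
[cite: Blaser2013, Thm. 7.5] -/
theorem omega_le_three_mul_of_sum_rpow_omega_le {r : ℕ} (hpr : p < r)
    (hmain : ∑ i, ((k i * m i * n i : ℕ) : ℝ) ^ (omega K / 3) ≤ r) {τ : ℝ}
    (hτ : ∑ i, ((k i * m i * n i : ℕ) : ℝ) ^ τ = r) : omega K ≤ 3 * τ := by
  by_contra hlt
  rw [not_le] at hlt
  have hlt' : τ < omega K / 3 := by linarith
  -- some block has `kᵢ mᵢ nᵢ ≥ 2`
  have hbig : ∃ i, 2 ≤ k i * m i * n i := by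
    by_contra hall
    push Not at hall
    have hle : ∑ i, ((k i * m i * n i : ℕ) : ℝ) ^ τ ≤ p := by
      calc ∑ i, ((k i * m i * n i : ℕ) : ℝ) ^ τ ≤ ∑ _i : Fin p, (1 : ℝ) := by
            refine Finset.sum_le_sum fun i _ => ?_
            have hi : k i * m i * n i = 0 ∨ k i * m i * n i = 1 := by have := hall i; omega
            rcases hi with hi | hi
            · rw [hi, Nat.cast_zero]
              rcases eq_or_ne τ 0 with hτ0 | hτ0
              · rw [hτ0, Real.rpow_zero]
              · rw [Real.zero_rpow hτ0]; exact zero_le_one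
            · rw [hi, Nat.cast_one, Real.one_rpow]
        _ = p := by simp
    rw [hτ] at hle
    exact absurd (Nat.cast_le.1 hle) (not_le.2 hpr)
  obtain ⟨i₀, hi₀⟩ := hbig
  -- `τ ≠ 0` (else `∑ 1 = p = r`)
  have hτ0 : τ ≠ 0 := by
    rintro rfl
    simp only [Real.rpow_zero, Finset.sum_const, Finset.card_univ, Fintype.card_fin,
      nsmul_eq_mul, mul_one] at hτ
    exact absurd (Nat.cast_injective hτ) hpr.ne
  -- termwise comparison, strict at `i₀`
  have hterm : ∀ i, ((k i * m i * n i : ℕ) : ℝ) ^ τ ≤ ((k i * m i * n i : ℕ) : ℝ) ^ (omega K / 3) := by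
    intro i
    rcases Nat.eq_zero_or_pos (k i * m i * n i) with h0 | hpos
    · have hω := omega_two_le (K := K)
      rw [h0, Nat.cast_zero, Real.zero_rpow hτ0, Real.zero_rpow (by positivity)]
    · exact Real.rpow_le_rpow_of_exponent_le (by exact_mod_cast hpos) hlt'.le
  have hstrict : ((k i₀ * m i₀ * n i₀ : ℕ) : ℝ) ^ τ <
      ((k i₀ * m i₀ * n i₀ : ℕ) : ℝ) ^ (omega K / 3) :=
    Real.rpow_lt_rpow_of_exponent_lt (by exact_mod_cast hi₀) hlt'
  have hsum : ∑ i, ((k i * m i * n i : ℕ) : ℝ) ^ τ <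
      ∑ i, ((k i * m i * n i : ℕ) : ℝ) ^ (omega K / 3) :=
    Finset.sum_lt_sum (fun i _ => hterm i) ⟨i₀, Finset.mem_univ _, hstrict⟩
  linarith

/-- **The rank version in Bläser's printed form** (Bläser 2013, Thm. 7.5 with `R` for `R̲`): if
`R(⊕_{i=1}^p ⟨kᵢ, mᵢ, nᵢ⟩) ≤ r` with `r > p`, then `ω ≤ 3τ` for the (unique) `τ` with
`∑ᵢ (kᵢ mᵢ nᵢ)^τ = r`. From `asymptoticSumInequality_rank`: `∑ (kᵢmᵢnᵢ)^{ω/3} ≤ r = ∑ (kᵢmᵢnᵢ)^τ`,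
and `omega_le_three_mul_of_sum_rpow_omega_le`. [cite: Blaser2013, Thm. 7.5] -/
theorem asymptoticSumInequality_rank_tau {r : ℕ} (hpr : p < r)
    (h : tensorRank (matMulDirectSum K k m n) ≤ r) {τ : ℝ}
    (hτ : ∑ i, ((k i * m i * n i : ℕ) : ℝ) ^ τ = r) : omega K ≤ 3 * τ :=
  omega_le_three_mul_of_sum_rpow_omega_le K k m n hpr (asymptoticSumInequality_rank K k m n h) hτ

end ASI

end Literature.Computability.AlgebraicComplexity

end
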